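/-
Copyright (c) 2026 the pub-hodgecm-mathlib formalisation cell (harness21).  Prover seat hodgecm-mathlib-K2E4-p08 (g2), Track B «K2-LIT» ∕ h413,
‹S› ROAD J brick J2♯ — THE LETTER: Rogawski's non-split Euler–Poincaré identity WITH THE NEGATIVE VALUE of `f_EP` at the central unit scalars, every non-split place.
2026-09-04.
-/
import Literature.NumberTheory.Rogawski1990.RankOneEulerPoincareNonsplitCentralValueRamified   -- ★ (this seat) p855726: the ramified leaf (+ p855689 witnesses, p855639 unramified leaf)
import Literature.NumberTheory.Rogawski1990.RankOneEulerPoincareNonsplitHolds                  -- ★ ROAD W fold: the ramified tree action `rhoVertexActPlace` and its (E) ∕ (N) feeders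
import HarnessLib

/-!
# (R2♯) Rogawski's non-split Euler–Poincaré identity with the negative central value — road J brick J2♯ (the letter)

`rankOneEulerPoincareNonsplit_withCentralValue`: the body of ★ `RankOneEulerPoincareNonsplit` VERBATIM (every CM field `L`, every place `v` of `L⁺` with one place of
`L` above it, every two-sided Haar `ν`, Borel σ-algebras on the orbit spaces, canonical orbital measures `m`: `∃ f ∈ C_c^∞(U(Φ₂)_v)` with orbital integral `1` on the
regular elliptic and `0` on the regular split classes) AND ONE MORE CONJUNCT: `∃ r > 0, ∀ z a, z = a·1 → f z = −r` — Kottwitz's Euler–Poincaré function takes ONE NEGATIVE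
real value at all central unit scalars ([Kottwitz1988, §2 Thm 2]: `f_EP(1) = χ_EP < 0` in rank one; [Rogawski1990, §8.1 p. 117, §12.6 p. 174]: the identity germ
`Γ₁ = (−1)^{q} d(St)⁻¹`, `q = 1`; [Rogawski1981ApplicationBuildingOrbitalIntegrals]).  This is the input (R2♯) = J2♯ of road J for the SIGNED singular transfer ‹S› of
crux h413: the sign of the singular sheet's coefficient is read off against `f_EP`.  Statement bytes = the cand `rankOneEPCentralValue.cand.K2E4-p08-g2` (7ed125cc)
token for token.

PROOF.  Place by place.  `w ∣ v` is `c`-fixed (one place above `v`).  UNRAMIFIED `v`: ★ p855639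
`exists_isLocSmooth_classOrbitalIntegral_eq_one_zero_and_apply_neg_of_unramified` at the `σ_w`-fixed uniformiser `ϖ = ι_w(ϖ_v)`.  RAMIFIED `v` (tame or wild):
★ p855726 `exists_isLocSmooth_classOrbitalIntegral_eq_one_zero_and_apply_neg_of_vertexEdgeLevels` at `D_η = diag(1, η)`, fed with Kottwitz's relations (E) and (N)
at `(K♯_η, K, K♯_η ⊓ K)` produced EXACTLY as in the ROAD W fold ★ `rankOneEulerPoincareNonsplit_holds`: B-p08's action `rhoVertexActPlace` of `U_w` on the tree of
`SL₂(L⁺_v)`, keyed by the anti-fixed dichotomy (`α` a unit: `K`-vertex ∕ `K♯_η`-edge, (E) ★ `epEllipticRelation_vertexEdgeLevels_of_vertexAction_local'`, (N) ★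
`epNonEllipticRelation_vertexEdgeLevels_of_vertexAction_local'`; `α` a uniformiser: `K♯_η`-vertex ∕ `K`-edge, the unprimed twins).

HONEST LABEL: a Literature-side helper toward h413 (`stmt-HodgeConjecture-24833`); HC_CM is proved only modulo its printed citations until rung 0 closes; this
file is unconditional.
-/

set_option autoImplicit false

noncomputable section

open scoped ValuativeRel Matrix MatrixGroups
open Matrix ValuativeRel NumberField IsDedekindDomain MeasureTheory Measure

namespace Literature.NumberTheory.Rogawski1990

open Literature.NumberTheory.Automorphic Literature.NumberTheory.Automorphic.UnitaryGroup Literature.NumberTheory.Automorphic.HermitianLatticeTree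
  Literature.NumberTheory.GaloisRepresentations

/-! ## §1 Two dispatch lemmas (private twins, to keep the import closure at the (R2) files) -/

/-- At a non-split `v` there is a `c`-fixed place `w ∣ v`. [cite: CasselsFrohlichANT1967, Ch. II §10] -/
private theorem exists_placesOver_smul_eq (L : Type) [Field L] [NumberField L] [IsCMField L]
    {v : HeightOneSpectrum (𝓞 ↥(maximalRealSubfield L))} (hsub : Subsingleton (UnitaryGroup.PlacesOver L v)) :
    ∃ w : UnitaryGroup.PlacesOver L v, IsCMField.complexConj L • w.1 = w.1 := by
  obtain ⟨w⟩ : Nonempty (UnitaryGroup.PlacesOver L v) := inferInstance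
  have h := congrArg Subtype.val (Subsingleton.elim (UnitaryGroup.PlacesOver.galInv (IsCMField.complexConj L) w) w)
  change (IsCMField.complexConj L)⁻¹ • w.1 = w.1 at h
  exact ⟨w, (inv_smul_eq_iff.1 h).symm⟩

/-- At a non-split `v` ramified in `L`, `e(w|v) ≠ 1` for the `c`-fixed `w ∣ v` (private twin of ★ p843559's lemma). [cite: NeukirchANT1999, Ch. I §8 Prop. (8.2)] -/
private theorem ramificationIdx'_ne_one_of_not_isUnramifiedIn₂ (L : Type) [Field L] [NumberField L] [IsCMField L]
    {v : HeightOneSpectrum (𝓞 ↥(maximalRealSubfield L))} (w : UnitaryGroup.PlacesOver L v) (hw : IsCMField.complexConj L • w.1 = w.1)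
    (hram : ¬ Algebra.IsUnramifiedIn (𝓞 L) v.asIdeal) : v.asIdeal.ramificationIdx' w.1.asIdeal ≠ 1 := by
  haveI : Algebra.IsQuadraticExtension ↥(maximalRealSubfield L) L := IsCMField.isQuadraticExtension L
  intro he
  apply hram
  intro P hP hPover
  have hP0 : P ≠ ⊥ := Ideal.ne_bot_of_liesOver_of_ne_bot v.ne_bot P
  have hPw : P = w.1.asIdeal :=
    congrArg (fun u : UnitaryGroup.PlacesOver L v => u.1.asIdeal)
      (UnitaryGroup.PlacesOver.eq_of_smul_eq (IsCMField.complexConj L) (IsCMField.complexConj_ne_one L) w hw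
        ⟨⟨P, hP, hP0⟩, HeightOneSpectrum.ext hPover.over.symm⟩)
  subst hPw
  haveI : v.asIdeal.IsMaximal := v.isMaximal
  rw [← Ideal.ramificationIdx_eq_one_iff, ← Ideal.ramificationIdx'_eq_ramificationIdx v.asIdeal w.1.asIdeal v.ne_bot]
  exact he

/-! ## §2 The letter -/

/-- **(R2♯) ROGAWSKI'S NON-SPLIT EULER–POINCARÉ IDENTITY WITH THE NEGATIVE CENTRAL VALUE.**  For every CM field `L`, every finite place `v` of `L⁺` with ONE place of
`L` above it, every two-sided Haar measure `ν` on `U(Φ₂)_v` and every canonical orbital-measure family `m`, there is `f ∈ C_c^∞(U(Φ₂)_v)` with orbital integral `1` at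
every regular elliptic class, `0` at every regular non-elliptic class, AND `f(a·1) = −r` for ONE `r > 0` and every central unit scalar `a·1` (Kottwitz's Euler–Poincaré
function: `χ_EP < 0` in rank one). [cite: Kottwitz1988, §2 Theorem 2] [cite: Rogawski1990, §8.1 p. 117; §12.6 p. 174] [cite: Serre1980Trees, Ch. II §1.1–§1.4]
[cite: Tits1979, §2.7 and §3.9] -/
theorem rankOneEulerPoincareNonsplit_withCentralValue :
  ∀ (L : Type) [Field L] [NumberField L] [IsCMField L] (v : HeightOneSpectrum (𝓞 ↥(maximalRealSubfield L))),
    Subsingleton (UnitaryGroup.PlacesOver L v) →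
    ∀ [MeasurableSpace ((UnitaryGroup.cmDatum L 2 (Matrix.of fun i j : Fin 2 => if i.val + j.val + 1 = 2 then (1 : L) else 0)).Local v)]
      [BorelSpace ((UnitaryGroup.cmDatum L 2 (Matrix.of fun i j : Fin 2 => if i.val + j.val + 1 = 2 then (1 : L) else 0)).Local v)]
      (ν : Measure ((UnitaryGroup.cmDatum L 2 (Matrix.of fun i j : Fin 2 => if i.val + j.val + 1 = 2 then (1 : L) else 0)).Local v))
      [ν.IsHaarMeasure] [ν.IsMulRightInvariant]
      [_iZ : ∀ γ : (UnitaryGroup.cmDatum L 2 (Matrix.of fun i j : Fin 2 => if i.val + j.val + 1 = 2 then (1 : L) else 0)).Local v,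
        MeasurableSpace (((UnitaryGroup.cmDatum L 2 (Matrix.of fun i j : Fin 2 => if i.val + j.val + 1 = 2 then (1 : L) else 0)).Local v) ⧸
          Subgroup.centralizer ({γ} : Set ((UnitaryGroup.cmDatum L 2 (Matrix.of fun i j : Fin 2 => if i.val + j.val + 1 = 2 then (1 : L) else 0)).Local v)))]
      [_bZ : ∀ γ : (UnitaryGroup.cmDatum L 2 (Matrix.of fun i j : Fin 2 => if i.val + j.val + 1 = 2 then (1 : L) else 0)).Local v,
        BorelSpace (((UnitaryGroup.cmDatum L 2 (Matrix.of fun i j : Fin 2 => if i.val + j.val + 1 = 2 then (1 : L) else 0)).Local v) ⧸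
          Subgroup.centralizer ({γ} : Set ((UnitaryGroup.cmDatum L 2 (Matrix.of fun i j : Fin 2 => if i.val + j.val + 1 = 2 then (1 : L) else 0)).Local v)))]
      (m : OrbitalMeasureFamily ((UnitaryGroup.cmDatum L 2 (Matrix.of fun i j : Fin 2 => if i.val + j.val + 1 = 2 then (1 : L) else 0)).Local v)),
      m.IsCanonical (fun γ => IsRegularElt (γ.val : GL (Fin 2) (UnitaryGroup.LocalRing L v))) ν →
      ∃ f : (UnitaryGroup.cmDatum L 2 (Matrix.of fun i j : Fin 2 => if i.val + j.val + 1 = 2 then (1 : L) else 0)).Local v → ℂ, IsLocSmooth f ∧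
        (∀ γ : (UnitaryGroup.cmDatum L 2 (Matrix.of fun i j : Fin 2 => if i.val + j.val + 1 = 2 then (1 : L) else 0)).Local v,
            IsRegularElt (γ.val : GL (Fin 2) (UnitaryGroup.LocalRing L v)) →
            CompactSpace (Subgroup.centralizer ({γ} : Set ((UnitaryGroup.cmDatum L 2 (Matrix.of fun i j : Fin 2 => if i.val + j.val + 1 = 2 then (1 : L) else 0)).Local v))) →
            classOrbitalIntegral m f (ConjClasses.mk γ) = 1) ∧
        (∀ γ : (UnitaryGroup.cmDatum L 2 (Matrix.of fun i j : Fin 2 => if i.val + j.val + 1 = 2 then (1 : L) else 0)).Local v,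
            IsRegularElt (γ.val : GL (Fin 2) (UnitaryGroup.LocalRing L v)) →
            ¬ CompactSpace (Subgroup.centralizer ({γ} : Set ((UnitaryGroup.cmDatum L 2 (Matrix.of fun i j : Fin 2 => if i.val + j.val + 1 = 2 then (1 : L) else 0)).Local v))) →
            classOrbitalIntegral m f (ConjClasses.mk γ) = 0) ∧
        (∃ r : ℝ, 0 < r ∧ ∀ (z : (UnitaryGroup.cmDatum L 2 (Matrix.of fun i j : Fin 2 => if i.val + j.val + 1 = 2 then (1 : L) else 0)).Local v) (a : UnitaryGroup.LocalRing L v),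
            ((z.val : GL (Fin 2) (UnitaryGroup.LocalRing L v)).val : Matrix (Fin 2) (Fin 2) (UnitaryGroup.LocalRing L v)) =
              a • (1 : Matrix (Fin 2) (Fin 2) (UnitaryGroup.LocalRing L v)) → f z = -(r : ℂ)) := by
  intro L _ _ _ v hsub _ _ ν _ _ _ _ m hm
  obtain ⟨w, hw⟩ := exists_placesOver_smul_eq L hsub
  by_cases hv : Algebra.IsUnramifiedIn (𝓞 L) v.asIdeal
  · -- UNRAMIFIED: ★ p855639 at the `σ_w`-fixed uniformiser `ϖ = ι_w(ϖ_v)`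
    exact exists_isLocSmooth_classOrbitalIntegral_eq_one_zero_and_apply_neg_of_unramified L w hw
      (Units.mk0 _ (toPlace_uniformizer_ne_zero L v w hv)) (valued_toPlace_uniformizer L v w hv)
      (galAdicCompletionMap_toPlace_self L v w hw _) ν hv hm
  · -- RAMIFIED: the ROAD W fold's tree action, then ★ p855726
    have he := ramificationIdx'_ne_one_of_not_isUnramifiedIn₂ L w hw hv
    obtain ⟨α, hα, hvα⟩ := exists_units_galAdicCompletionMap_complexConj_eq_neg_of_ramified L w hw he
    have hα0 : (α : w.1.adicCompletion L) ≠ 0 := α.ne_zero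
    obtain ⟨ϖF, hϖF⟩ : ∃ ϖF : v.adicCompletion ↥(maximalRealSubfield L), Valued.v ϖF = WithZero.exp (-1 : ℤ) :=
      ⟨_, HeckeCharacter.valued_uniformizer (K := ↥(maximalRealSubfield L)) (v := v)⟩
    obtain ⟨η, hη⟩ : ∃ η : (w.1.adicCompletion L)ˣ, Valued.v (η : w.1.adicCompletion L) = WithZero.exp (-1 : ℤ) :=
      ⟨_, HeckeCharacter.valued_uniformizer (K := L) (v := w.1)⟩
    haveI : IsDiscreteValuationRing 𝒪[v.adicCompletion ↥(maximalRealSubfield L)] := isDiscreteValuationRing_integer_of_compatible hϖF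
    have hϖ : IsUniformizingElement ϖF := isUniformizingElement_of_v_eq hϖF
    obtain ⟨g₁, hg₁, hdet₁⟩ := exists_coe_eq_diagonal_one_uniformizer (F := v.adicCompletion ↥(maximalRealSubfield L)) hϖ.ne_zero
    obtain ⟨v₀, v₁, hv₀, hv₁⟩ : ∃ v₀ v₁ : {M : Submodule 𝒪[v.adicCompletion ↥(maximalRealSubfield L)] (Fin 2 → v.adicCompletion ↥(maximalRealSubfield L)) //
        IsSpecialLattice (RingHom.id _) ϖF !![(0 : v.adicCompletion ↥(maximalRealSubfield L)), 1; -1, 0] M},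
        v₀.1 = latt (1 : Matrix (Fin 2) (Fin 2) (v.adicCompletion ↥(maximalRealSubfield L))) ∧
          v₁.1 = latt (Matrix.diagonal ![(1 : v.adicCompletion ↥(maximalRealSubfield L)), ϖF]) :=
      ⟨⟨latt (1 : Matrix (Fin 2) (Fin 2) (v.adicCompletion ↥(maximalRealSubfield L))),
          Or.inl ((isSelfDualLattice_id_altJ_iff _).2 ⟨1, by rw [Units.val_one], by rw [Units.val_one, det_one, map_one]⟩)⟩,
        ⟨latt (Matrix.diagonal ![(1 : v.adicCompletion ↥(maximalRealSubfield L)), ϖF]),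
          Or.inr ((isModularLattice_id_altJ_iff hϖ.ne_zero _).2 ⟨g₁, by rw [hg₁], by rw [hdet₁]⟩)⟩, rfl, rfl⟩
    have hX := isTree_latticeTree_id_altJ hϖ
    have h01 := latticeTree_adj_root hϖ v₀ v₁ hv₀ hv₁
    rcases hvα with hvα | hvα
    · -- `E_w = F_v(√u)`-TYPE (`α` an anti-fixed UNIT): `K`-vertex `x₀ = v₀`, `K♯_{D_η}`-edge `{v₀, v₁}`
      exact exists_isLocSmooth_classOrbitalIntegral_eq_one_zero_and_apply_neg_of_vertexEdgeLevels L w hw ν he η hη hm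
        (fun γ hreg hc => epEllipticRelation_vertexEdgeLevels_of_vertexAction_local' L w hw (glDiagonal 2 (w.1.adicCompletion L) ![1, η]) hX
          (rhoVertexActPlace L v w hw hα hα0 hϖF) (rhoVertexActPlace_one L v w hw hα hα0 hϖF) (rhoVertexActPlace_mul L v w hw hα hα0 hϖF)
          (latticeTree_adj_rhoVertexActPlace_iff L v w hw hα hα0 hϖF) h01 (exists_rhoVertexActPlace_eq L v w hw hα hα0 hϖF he v₀ hv₀)
          (fun _ _ hab => exists_rhoVertexActPlace_eq_of_adj L v w hw hα hα0 hϖF he v₀ v₁ hv₀ hv₁ hab)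
          (forall_coe_mem_glInt_iff_rhoVertexActPlace_root_eq L v w hw hα hα0 hϖF v₀ hv₀ hvα)
          (forall_coe_mem_map_conj_glDiagonal_iff_sym2_rhoVertexActPlace_eq L v w hw hα hα0 hϖF v₀ v₁ hv₀ hv₁ he hvα η hη) γ hreg hc)
        (fun γ hreg hnc => epNonEllipticRelation_vertexEdgeLevels_of_vertexAction_local' L w hw η hη ν ![1, η] hm hX
          (rhoVertexActPlace L v w hw hα hα0 hϖF) (rhoVertexActPlace_one L v w hw hα hα0 hϖF) (rhoVertexActPlace_mul L v w hw hα hα0 hϖF)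
          (latticeTree_adj_rhoVertexActPlace_iff L v w hw hα hα0 hϖF) h01 (exists_rhoVertexActPlace_eq L v w hw hα hα0 hϖF he v₀ hv₀)
          (fun _ _ hab => exists_rhoVertexActPlace_eq_of_adj L v w hw hα hα0 hϖF he v₀ v₁ hv₀ hv₁ hab)
          (forall_coe_mem_glInt_iff_rhoVertexActPlace_root_eq L v w hw hα hα0 hϖF v₀ hv₀ hvα)
          (forall_coe_mem_map_conj_glDiagonal_iff_sym2_rhoVertexActPlace_eq L v w hw hα hα0 hϖF v₀ v₁ hv₀ hv₁ he hvα η hη)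
          (latticeTree_adj_root_rhoVertexActPlace_of_coe_eq_diagonal L v w hw hα hα0 hϖF he η hη v₀ hv₀) γ hreg hnc)
    · -- `E_w = F_v(√π)`-TYPE (`α` an anti-fixed UNIFORMISER): `K♯_{D_η}`-vertex `x₀ = v₁`, `K`-edge `{v₁, v₀}`
      exact exists_isLocSmooth_classOrbitalIntegral_eq_one_zero_and_apply_neg_of_vertexEdgeLevels L w hw ν he η hη hm
        (fun γ hreg hc => epEllipticRelation_vertexEdgeLevels_of_vertexAction_local L w hw (glDiagonal 2 (w.1.adicCompletion L) ![1, η]) hX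
          (rhoVertexActPlace L v w hw hα hα0 hϖF) (rhoVertexActPlace_one L v w hw hα hα0 hϖF) (rhoVertexActPlace_mul L v w hw hα hα0 hϖF)
          (latticeTree_adj_rhoVertexActPlace_iff L v w hw hα hα0 hϖF) h01.symm (exists_rhoVertexActPlace_eq' L v w hw hα hα0 hϖF he v₁)
          (fun _ _ hab => exists_rhoVertexActPlace_eq_of_adj' L v w hw hα hα0 hϖF he v₁ v₀ hv₁ hv₀ hab)
          (forall_coe_mem_map_conj_glDiagonal_iff_rhoVertexActPlace_next_eq L v w hw hα hα0 hϖF v₁ hv₁ he hvα η hη)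
          (forall_coe_mem_glInt_iff_sym2_rhoVertexActPlace_eq L v w hw hα hα0 hϖF v₀ v₁ hv₀ hv₁ he hvα) γ hreg hc)
        (fun γ hreg hnc => epNonEllipticRelation_vertexEdgeLevels_of_vertexAction_local L w hw η hη ν ![1, η] hm hX
          (rhoVertexActPlace L v w hw hα hα0 hϖF) (rhoVertexActPlace_one L v w hw hα hα0 hϖF) (rhoVertexActPlace_mul L v w hw hα hα0 hϖF)
          (latticeTree_adj_rhoVertexActPlace_iff L v w hw hα hα0 hϖF) h01.symm (exists_rhoVertexActPlace_eq' L v w hw hα hα0 hϖF he v₁)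
          (fun _ _ hab => exists_rhoVertexActPlace_eq_of_adj' L v w hw hα hα0 hϖF he v₁ v₀ hv₁ hv₀ hab)
          (forall_coe_mem_map_conj_glDiagonal_iff_rhoVertexActPlace_next_eq L v w hw hα hα0 hϖF v₁ hv₁ he hvα η hη)
          (forall_coe_mem_glInt_iff_sym2_rhoVertexActPlace_eq L v w hw hα hα0 hϖF v₀ v₁ hv₀ hv₁ he hvα)
          (latticeTree_adj_root_rhoVertexActPlace_of_coe_eq_diagonal' L v w hw hα hα0 hϖF he η hη v₁ hv₁) γ hreg hnc)

end Literature.NumberTheory.Rogawski1990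

end
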